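import Summits.ResolutionOfSingularities.ResolutionOfSingularities.Theses.OrderCut
import Summits.ResolutionOfSingularities.ResolutionOfSingularities.Theses.MaxContactCut
import Summits.ResolutionOfSingularities.ResolutionOfSingularities.Theorems.MaxContactCutExhaustion
import Summits.ResolutionOfSingularities.ResolutionOfSingularities.Theorems.MaxContactCutTauCut
import Summits.ResolutionOfSingularities.ResolutionOfSingularities.Theorems.WeakOrderReduction
import HarnessLib

/-!
# MaxContactCutTauLadder — kernels of the decomp-res node «TauLadder» (lens-2 g6) BY NAME

Source HOME/decomp-res-lens-2/g6/TauLadder.lean (sha256 4e7e109c…, critic `lean check` rc 0 · 0 sorry), CRITIC-LEDGER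
row 40: CLEARED AS ATTACK NODE in SEQUENCE form inside the Perfect column.  The pieces are the route asides
`MaxContactCut.RungFour` (E 5 → E 4, KNOWN-MOD-PORT | Perfect), `RungThree` (E 4 → E 3, KNOWN-MOD-PORT | Perfect),
`RungTwo` (E 3 → E 2, UNDECIDED, small-seam: the grade where print stops), `RungOne` (E 2 → E 1, THE CORE = 28544 in
sequence form, declared residual) and the costume `SequenceToStepAll` (E 1 → StepDimFour); the graded statements
`E j` / `SeqDimFour j n` live in the route-independent module `Theorems.WeakOrderReduction` (phase 1, commit
86c16e68c9aa).  This file proves: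

* DEDUP: `weakAdmissible_iff`, `weakResolution_iff` — the route-independent `WeakOrderReduction.WeakAdmissible /
  WeakResolution` agree with the N27 notions in `Theorems.MaxContactCutExhaustion` (same recursion); hence
  `seqDimFour_five_iff : SeqDimFour 5 n ↔ ContactOrderSequenceDimFourAt n` and `e_five_iff : E 5 ↔
  ContactOrderSequenceDimFour` (lens-5's contact family BY NAME);
* `e_five_of_items` (E 5 ⟸ X1 port 28616 + CJS SequenceB + lens-5's `ExhaustionBridge`), `e_one_of_ladder`,
  `e_one_iff_ladder` (EXACTNESS relative to E 1: each rung ⟸ E 1 by letter);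
* `closes : ContactOrderSequenceDimFour → RungFour → RungThree → RungTwo → RungOne → SequenceToStepAll →
  StepDimFour ∧ StepContactDimFour ∧ StepContactFreeDimFour ∧ StepCFHigherDimFour ∧ StepPICoreDimFour` (28011,
  28009, 28010, 28543, 28544 BY NAME), `closes_pocket` (OrderCut.PencilResolveDimFour 27135), `closes_items`;
* necessity of the OUTPUT 27135 from the root; the conjunct drops, the order induction, `stepDimFour_of_summit` and
  `closes_root = MaxContactCut.closes` are REUSED from `MaxContactCutTauCut` / `MaxContactCutExhaustion` (dedup.landed).

No blow-up is performed in Lean; the mathematics is in the pieces. [BenitoVillamayor2012 = arXiv:1103.3464 Thm 2.11;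
BierstoneGrigorievMilmanWlodarczyk2011 Def. 3.1.3; Cutkosky2009 Thm 5.1]
-/

open CategoryTheory AlgebraicGeometry
open Literature.AlgebraicGeometry.Resolution
open Summit.ResolutionOfSingularities.ResolutionOfSingularities.Theses
open Summit.ResolutionOfSingularities.ResolutionOfSingularities.Theorems.WeakOrderReduction

namespace Summit.ResolutionOfSingularities.ResolutionOfSingularities.Theorems.MaxContactCutTauLadder

/-! ## Dedup kernels: the route-independent weak-resolution notions = the N27 notions -/

/-- `WeakOrderReduction.WeakAdmissible` IS `MaxContactCutExhaustion.WeakAdmissible` (same structural recursion). -/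
theorem weakAdmissible_iff : ∀ {X : Scheme.{0}} (s : CentreSeq X) (M : MarkedIdeal X),
    WeakAdmissible s M ↔ MaxContactCutExhaustion.WeakAdmissible s M
  | _, .nil _, _ => by simp [WeakAdmissible, MaxContactCutExhaustion.WeakAdmissible]
  | _, .cons C rest, M => by
      simp only [WeakAdmissible, MaxContactCutExhaustion.WeakAdmissible]
      rw [weakAdmissible_iff rest]

/-- `WeakOrderReduction.WeakResolution` IS `MaxContactCutExhaustion.WeakResolution`. -/
theorem weakResolution_iff {X : Scheme.{0}} (s : CentreSeq X) (M : MarkedIdeal X) :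
    WeakResolution s M ↔ MaxContactCutExhaustion.WeakResolution s M := by
  unfold WeakResolution MaxContactCutExhaustion.WeakResolution
  rw [weakAdmissible_iff]

/-- `SeqDimFour 5 n` IS the tree's (lens-5) `ContactOrderSequenceDimFourAt n` (class ≥ 5 ⟺ contact). -/
theorem seqDimFour_five_iff (n : ℕ) :
    SeqDimFour 5 n ↔ MaxContactCutExhaustion.ContactOrderSequenceDimFourAt n := by
  constructor
  · intro h p hp k _ _ Y g hg1 hg2 hg3 hY hY4 I hord hc
    obtain ⟨t, ht⟩ := h p hp k Y g hg1 hg2 hg3 hY hY4 I hord fun y hy => Or.inr (Or.inl (hc y hy))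
    exact ⟨t, (weakResolution_iff t _).mp ht⟩
  · intro h p hp k _ _ Y g hg1 hg2 hg3 hY hY4 I hord hcls
    obtain ⟨t, ht⟩ := h p hp k Y g hg1 hg2 hg3 hY hY4 I hord fun y hy => by
      rcases hcls y hy with h1 | h2 | ⟨h3, -⟩
      · omega
      · exact h2
      · omega
    exact ⟨t, (weakResolution_iff t _).mpr ht⟩

/-- `E 5` IS the tree's (lens-5) `ContactOrderSequenceDimFour`. -/
theorem e_five_iff : E 5 ↔ MaxContactCutExhaustion.ContactOrderSequenceDimFour :=
  ⟨fun h n hn => (seqDimFour_five_iff n).mp (h n hn), fun h n hn => (seqDimFour_five_iff n).mpr (h n hn)⟩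

/-- `E 5` from the TREE's booked inputs of N27: the X1 port (28616), the CJS fact and lens-5's exhaustion bridge. -/
theorem e_five_of_items (hM : MaxContactCut.MarkedThreefoldResolution)
    (hC : CossartJannsenSaito2020EmbeddedSequenceB.{0}) (hB : MaxContactCutExhaustion.ExhaustionBridge) : E 5 :=
  e_five_iff.mpr (MaxContactCutExhaustion.contactOrderSequenceDimFour_of hM hC hB)

/-- The perfect-field slice of R4 follows from R4. -/
theorem rungFourPerfect_of (h : MaxContactCut.RungFour) : E 5 → ∀ n : ℕ, 1 ≤ n → SeqDimFourPerfect 4 n :=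
  fun h5 n hn => seqDimFourPerfect_of_seqDimFour (h h5 n hn)

/-- The perfect-field slice of R3 follows from R3. -/
theorem rungThreePerfect_of (h : MaxContactCut.RungThree) : E 4 → ∀ n : ℕ, 1 ≤ n → SeqDimFourPerfect 3 n :=
  fun h4 n hn => seqDimFourPerfect_of_seqDimFour (h h4 n hn)

/-- **The ladder composes**: lens-5's contact family and the four rungs give weak order reduction for ALL dim-4
data. -/
theorem e_one_of_ladder (h5 : MaxContactCutExhaustion.ContactOrderSequenceDimFour) (r4 : MaxContactCut.RungFour)
    (r3 : MaxContactCut.RungThree) (r2 : MaxContactCut.RungTwo) (r1 : MaxContactCut.RungOne) : E 1 :=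
  r1 (r2 (r3 (r4 (e_five_iff.mpr h5))))

/-- **EXACTNESS** of the ladder: the full dim-4 order reduction is EQUIVALENT to lens-5's contact family plus the
four rungs (each rung is implied by `E 1`; no piece exceeds the target by letter). -/
theorem e_one_iff_ladder : E 1 ↔ MaxContactCutExhaustion.ContactOrderSequenceDimFour ∧ MaxContactCut.RungFour ∧
    MaxContactCut.RungThree ∧ MaxContactCut.RungTwo ∧ MaxContactCut.RungOne :=
  ⟨fun h => ⟨e_five_iff.mp (e_mono (by norm_num) h), fun _ => e_mono (by norm_num) h,
      fun _ => e_mono (by norm_num) h, fun _ => e_mono (by norm_num) h, fun _ => h⟩,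
    fun h => e_one_of_ladder h.1 h.2.1 h.2.2.1 h.2.2.2.1 h.2.2.2.2⟩

/-! ## Down to MaxContactCut's dim-4 items BY NAME -/

/-- Conjunct drop: the whole dim-4 step gives the contact-free higher-τ class (28543). -/
theorem stepCFHigherDimFour_of_stepDimFour (h : MaxContactCut.StepDimFour) : MaxContactCut.StepCFHigherDimFour := by
  intro p hp k _ _ n hn ih Y g hg1 hg2 hg3 hY hY4 Γ b hb1 hb2 hb3 hbb hΓ hdat
  obtain ⟨I, hbl, hord, -, hloc⟩ := hdat
  exact h p hp k n hn ih Y g hg1 hg2 hg3 hY hY4 Γ b hb1 hb2 hb3 hbb hΓ ⟨I, hbl, hord, hloc⟩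

/-- Conjunct drop: the whole dim-4 step gives the purely inseparable core class (28544). -/
theorem stepPICoreDimFour_of_stepDimFour (h : MaxContactCut.StepDimFour) : MaxContactCut.StepPICoreDimFour := by
  intro p hp k _ _ n hn ih Y g hg1 hg2 hg3 hY hY4 Γ b hb1 hb2 hb3 hbb hΓ hdat
  obtain ⟨I, hbl, hord, -, hloc⟩ := hdat
  exact h p hp k n hn ih Y g hg1 hg2 hg3 hY hY4 Γ b hb1 hb2 hb3 hbb hΓ ⟨I, hbl, hord, hloc⟩

/-- **DECIDING IMPLICATION of the node**: lens-5's contact family, the four τ-rungs and the costume step-glue give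
    the WHOLE
dim-4 step (28011) and hence each of its booked classes BY NAME (28009, 28010, 28543, 28544). -/
theorem closes (h5 : MaxContactCutExhaustion.ContactOrderSequenceDimFour) (r4 : MaxContactCut.RungFour) (r3 :
    MaxContactCut.RungThree) (r2 : MaxContactCut.RungTwo) (r1 : MaxContactCut.RungOne)
    (hS : MaxContactCut.SequenceToStepAll) :
    MaxContactCut.StepDimFour ∧ MaxContactCut.StepContactDimFour ∧ MaxContactCut.StepContactFreeDimFour ∧
      MaxContactCut.StepCFHigherDimFour ∧ MaxContactCut.StepPICoreDimFour :=
  have hD : MaxContactCut.StepDimFour := hS (e_one_of_ladder h5 r4 r3 r2 r1)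
  ⟨hD, MaxContactCutTauCut.stepContactDimFour_of_stepDimFour hD,
    MaxContactCutTauCut.stepContactFreeDimFour_of_stepDimFour hD,
    stepCFHigherDimFour_of_stepDimFour hD, stepPICoreDimFour_of_stepDimFour hD⟩

/-! ## The dim-4 pocket `OrderCut.PencilResolveDimFour` (27135) BY NAME -/

/-- The dim-4 pencil pocket from the order bound, the order-one base and the step. -/
theorem pencilResolveDimFour_of_step (hB : MaxContactCut.OrderBound) (h1 : MaxContactCut.LocalOrderOneResolveDimFour)
    (hS : MaxContactCut.StepDimFour) : OrderCut.PencilResolveDimFour := by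
  intro p hp k _ _ Y g hg1 hg2 hg3 hY hY4 Γ b hb1 hb2 hb3 hbb hΓ hpen
  obtain ⟨I, hbl, hloc⟩ := hpen
  obtain ⟨N, hN⟩ := hB p hp k Y g hg1 hg2 hg3 hY Γ b hb1 hb2 hb3 hbb hΓ I hbl hloc
  exact MaxContactCutTauCut.prLEDimFour_of_base_of_step h1 hS p hp k N Y g hg1 hg2 hg3 hY hY4 Γ b hb1 hb2 hb3 hbb hΓ
    ⟨I, hbl, hN, hloc⟩

/-- **THE DIM-4 LEDGER**: modulo the order bound (OrderCut costume) and the order-one base PR¹₄ (28008,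
lens-3/lens-5: closed-mod-library), the dim-4 pencil residual 27135 follows from lens-5's contact family, the
four τ-rungs and the step glue — R4, R3 known-mod-port over perfect k, R2 the unprinted (4,2) grade, R1 the core. -/
theorem closes_pocket (hB : MaxContactCut.OrderBound) (h1 : MaxContactCut.LocalOrderOneResolveDimFour) (h5 :
    MaxContactCutExhaustion.ContactOrderSequenceDimFour)
    (r4 : MaxContactCut.RungFour) (r3 : MaxContactCut.RungThree) (r2 : MaxContactCut.RungTwo) (r1 :
        MaxContactCut.RungOne) (hS : MaxContactCut.SequenceToStepAll) :
    OrderCut.PencilResolveDimFour :=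
  pencilResolveDimFour_of_step hB h1 (closes h5 r4 r3 r2 r1 hS).1

/-- **THE DIM-4 LEDGER FROM BOOKED ITEMS**: X1 port 28616 + CJS fact + lens-5's `ExhaustionBridge` (N27) + the four
    τ-rungs + the
step glue + OrderBound + PR¹₄ (28008) ⟹ the whole dim-4 step 28011 and the pencil pocket 27135. -/
theorem closes_items (hB : MaxContactCut.OrderBound) (h1 : MaxContactCut.LocalOrderOneResolveDimFour)
    (hM : MaxContactCut.MarkedThreefoldResolution) (hC : CossartJannsenSaito2020EmbeddedSequenceB.{0})
    (hX : MaxContactCutExhaustion.ExhaustionBridge) (r4 : MaxContactCut.RungFour) (r3 : MaxContactCut.RungThree) (r2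
        : MaxContactCut.RungTwo) (r1 : MaxContactCut.RungOne)
    (hS : MaxContactCut.SequenceToStepAll) : MaxContactCut.StepDimFour ∧ OrderCut.PencilResolveDimFour :=
  have h5 : MaxContactCutExhaustion.ContactOrderSequenceDimFour :=
    MaxContactCutExhaustion.contactOrderSequenceDimFour_of hM hC hX
  ⟨(closes h5 r4 r3 r2 r1 hS).1, closes_pocket hB h1 h5 r4 r3 r2 r1 hS⟩

/-! ## Necessity of the OUTPUTS from the root (the E/R pieces are in sequence form and not summit-implied — declared)
    -/

/-- Necessity of the OUTPUT 27135 from the root. -/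
theorem pencilResolveDimFour_of_summit (h : _root_.ResolutionOfSingularities) : OrderCut.PencilResolveDimFour :=
  fun _p hp k _ _ _Y g hg1 hg2 hg3 _hY _hY4 _Γ b hb1 hb2 hb3 _hbb hΓ _ =>
    MaxContactCutTauCut.hasResolution_of_summit h hp k g hg1 hg2 hg3 b hb1 hb2 hb3 hΓ

end Summit.ResolutionOfSingularities.ResolutionOfSingularities.Theorems.MaxContactCutTauLadder
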